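import Mathlib.MeasureTheory.Measure.WithDensity
import Mathlib.MeasureTheory.Measure.Haar.NormedSpace
import Mathlib.MeasureTheory.Constructions.HaarToSphere
import Mathlib.MeasureTheory.Integral.Average
import Mathlib.Topology.ContinuousMap.Bounded.Basic
import Mathlib.Analysis.Calculus.BumpFunction.Basic
import Mathlib.Analysis.Calculus.BumpFunction.InnerProduct
import Mathlib.Analysis.Calculus.BumpFunction.Normed
import Mathlib.Analysis.Calculus.Gradient.Basic
import Literature.Analysis.FunctionSpaces.FlatTorus
import Literature.Analysis.FunctionSpaces.TorusCalculus
import Literature.Analysis.FunctionSpaces.TorusTestFunction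
import Literature.Analysis.FunctionSpaces.TorusFluidGlue
import Literature.Analysis.FluidPDE.VectorCalculus
import Literature.Analysis.FluidPDE.WeakSolution
import Literature.Analysis.FluidPDE.LerayHopf
import HarnessLib

-- provenance: harness21/H21/H21/Prelude/FluidKinetic/DissipationAnomaly.lean @ 5e1bfb2 (interim HEAD d8f2665); M5 mechanical rewrite
/-!
# Anomalous dissipation: dissipation measures, the Duchon–Robert defect, 4/5 and 4/3 laws

Trunk: FluidKinetic (outline `H21/Outlines/FluidKinetic.md`, item F13 `DissipationAnomaly`;
notions `dissipation_measure_weak_limits`, `structure_functions_intermittency`).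

All fields live on the flat unit torus `T^d = UnitAddTorus d`, time first:
`u : ℝ → UnitAddTorus d → EuclideanSpace ℝ d`.

## Contents

* **Vanishing viscosity / weak-* limits** (DiPerna–Majda 1987, §1): `Torus.TendstoWeakStar`
  (weak-* convergence in `L^∞(0,T; L²)` on bounded sets, tested against smooth space–time test
  fields supported in `(0, T)`).
* **Weak gradients and the dissipation measure** `ν |∇u|² dx dt`: `Torus.HasWeakGradient v G`
  (all weak partial derivatives, G03 `Torus.HasWeakPartialDeriv`), the density
  `Torus.weakGradNormSq G x := Fluid.frobeniusNormSq (G x)` (the accepted basis-free Frobenius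
  norm; `= ∑ᵢ ‖G x eᵢ‖²`, `weakGradNormSq_eq_sum`), the measure `Torus.dissipationMeasure ν G T` on
  `ℝ × T^d`, weak limits `Torus.IsDissipationMeasureOf`, and anomalous dissipation
  `Torus.HasAnomalousDissipationMeasure` (DiPerna–Majda 1987, §1; Buckmaster–Vicol, EMS Surv.
  2019, §8). **The density never uses the pointwise `Torus.partialDeriv`** (junk `0` on the rough
  Leray–Hopf fields it is applied to); the link from the spectral Leray–Hopf class
  `Torus.MemL2Sobolev 0 T 1` to a weak gradient is `Torus.IsLerayHopfOn.exists_hasWeakGradient`.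
* **Duchon–Robert** (Nonlinearity 13 (2000), (6)–(10), Prop. 2): mollifiers `Fluid.IsMollifier`,
  `Fluid.mollifierScale ε φ = ε^{-d} φ(·/ε)`, increments `Torus.increment u ξ x = u(x + ξ) − u(x)`,
  the local flux `Torus.duchonRobertApprox φ ε u x = ¼ ∫ ∇φ^ε(ξ) · δu |δu|² dξ`, the defect
  distribution `Torus.HasDuchonRobertDefect T u D` and the local energy balance
  `Torus.HasLocalEnergyBalance` (DR (10)).
* **4/5 and 4/3 laws** (Eyink, Nonlinearity 16 (2003), (1.5)–(1.7); Duchon–Robert 2000, §4):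
  sphere averages `Torus.sphereAvg` (Mathlib's `⨍ … ∂(volume.toSphere)`), the fluxes
  `Torus.longitudinalFluxSphereAvg`, `Torus.energyFluxSphereAvg`, and the predicates
  `Torus.HasFourFifthsLaw`, `Torus.HasFourThirdsLaw`.

## Mathlib search

Mathlib (this pin) has: `Measure.withDensity`, `Measure.toSphere` (`HaarToSphere`), the average
`⨍` (`MeasureTheory.average`), bounded continuous functions `α →ᵇ ℝ`, normed bump functions
`ContDiffBump.normed` with `contDiff_normed`, `hasCompactSupport_normed`, `normed_neg`,
`nonneg_normed`, `integral_normed` (the anchor of `Fluid.isMollifier_normed`), and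
`Measure.integral_comp_inv_smul_of_nonneg` (rescaling). It has no mollifier *predicate*, no
structure functions, no dissipation measures, no weak-* convergence predicate for `L^∞_t L²_x`
(searched `mollifier`, `Mollifier`, `structureFunction`, `WeakStar` + `Lp`: none relevant), and
`Mathlib.MeasureTheory.Measure.Portmanteau` works with `ProbabilityMeasure`/`FiniteMeasure`
bundles; we state weak convergence of measures directly against `(ℝ × T^d) →ᵇ ℝ`.

## Design notes

* `Torus.increment u ξ x := u (x + Torus.proj ξ) - u x` is the **verbatim twin** of the accepted
  `Literature.Turb.velocityIncrement u ⇑ξ x` (Statements/Turb/Wave0: `u (x + toTorus r) - u x`), since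
  `Torus.proj ξ = Turb.toTorus ⇑ξ` definitionally; the `rfl` bridge is stated in
  `Statements/Turb/DuchonRobert`, which imports both (import policy: Prelude does not import
  Statements).
* `Torus.IsDissipationMeasureOf` additionally records that the chosen weak gradients `G_m` are
  **jointly a.e.-strongly measurable** on `[0, T] × T^d` (`AEStronglyMeasurable (uncurry (G_m))`;
  without this `withDensity` of a non-measurable density would not determine the measure and
  `IsDissipationMeasureOf.unique` would fail), integrable in `x` for a.e. `t` (so that they are
  a.e. unique, `HasWeakPartialDeriv.unique`, killing the Bochner junk in `HasWeakPartialDeriv`)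
  and that each `ν_m |∇u_m|²` is a finite measure (`∇u_m ∈ L²_{t,x}`, the Leray–Hopf class). The
  same joint measurability is part of the conclusions of
  `IsLerayHopfOn.exists_hasWeakGradient` / `exists_dissipationMeasure_univ_le` (Fourier partial
  sums furnish jointly measurable representatives).
* `Torus.STFunctional d = (ℝ → T^d → ℝ) → ℝ` is unbundled (no linearity/continuity): v0
  bookkeeping, design debt recorded alongside `Torus.Distribution`.
* `Torus.TendstoWeakStar.exists_subseq_isDissipationMeasureOf` is the DiPerna–Majda-flavoured
  wrapper (the subsequence keeps the weak-* limit) of the hypothesis-minimal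
  `exists_subseq_isDissipationMeasureOf_of_isLerayHopfOn`, from which it is derived.
* `HasDuchonRobertDefect.hasFourThirdsLaw` / `hasFourFifthsLaw` both assume a weak Euler
  solution (`IsWeakEulerSolutionOn`), as in Duchon–Robert 2000 §4 and Eyink 2003 Thm. 1.
* `Torus.HasLocalEnergyBalance` takes the weak spatial gradient `G` as an explicit argument and
  demands `G t` to be a weak gradient of `u t` for a.e. `t` only when `ν ≠ 0` (for Euler the
  viscous terms vanish and `G` is irrelevant).
* Junk values: `duchonRobertApprox`, the fluxes and all pairings are Bochner integrals (junk `0`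
  off integrability); `sphereAvg` is Mathlib's average (junk `0` for the zero measure, i.e. when
  `d` is empty). All predicates consuming them are limits tested against smooth test fields.

## References

* R. J. DiPerna, A. J. Majda, *Oscillations and concentrations in weak solutions of the
  incompressible fluid equations*, Comm. Math. Phys. 108 (1987), §1.
* J. Duchon, R. Robert, *Inertial energy dissipation for weak solutions of incompressible Euler
  and Navier–Stokes equations*, Nonlinearity 13 (2000), (6)–(10), Prop. 2, §4.
* G. L. Eyink, *Local 4/5-law and energy dissipation anomaly in turbulence*, Nonlinearity 16
  (2003), (1.5)–(1.7).
* T. Buckmaster, V. Vicol, *Convex integration and phenomenologies in turbulence*, EMS Surv.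
  Math. Sci. 6 (2019), §8.
* L. C. Evans, *Partial Differential Equations* (2nd ed., 2010), §5.2.1, App. C.4 (mollifiers).
-/

noncomputable section

open MeasureTheory TopologicalSpace Set Function Filter Topology Metric
open scoped InnerProductSpace RealInnerProductSpace ENNReal NNReal BoundedContinuousFunction

/-! ## Mollifiers on `ℝ^d` -/

namespace Literature.Analysis.FluidPDE

variable {d : Type*} [Fintype d]

open scoped ContDiff in
/-- A (standard, symmetric) **mollifier** on `ℝ^d`: `φ ∈ C_c^∞(ℝ^d)`, even, nonnegative, with
`∫ φ = 1` (Duchon–Robert 2000, before (6): "`φ` any infinitely differentiable function with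
compact support, even, non-negative with integral one"; Evans, App. C.4). Smoothness is
Mathlib's `ContDiff ℝ ∞` (scoped notation `ContDiff`, opened locally: the global `∞` clashes
with `ℝ≥0∞`). [cite: DuchonRobert2000, before (6] -/
def IsMollifier (φ : EuclideanSpace ℝ d → ℝ) : Prop :=
  ContDiff ℝ ∞ φ ∧ HasCompactSupport φ ∧ (∀ ξ, φ (-ξ) = φ ξ) ∧
    (∀ ξ, 0 ≤ φ ξ) ∧ ∫ ξ, φ ξ = 1

/-- The rescaled mollifier `φ^ε(ξ) = ε^{-d} φ(ξ/ε)` (Duchon–Robert 2000, before (6); Evans,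
App. C.4). Meaningful for `ε > 0`. [cite: DuchonRobert2000, before (6] -/
def mollifierScale (ε : ℝ) (φ : EuclideanSpace ℝ d → ℝ) (ξ : EuclideanSpace ℝ d) : ℝ :=
  (ε ^ Fintype.card d)⁻¹ * φ (ε⁻¹ • ξ)

/-- Unfolding `mollifierScale`. [folklore] -/
theorem mollifierScale_apply (ε : ℝ) (φ : EuclideanSpace ℝ d → ℝ) (ξ : EuclideanSpace ℝ d) :
    mollifierScale ε φ ξ = (ε ^ Fintype.card d)⁻¹ * φ (ε⁻¹ • ξ) :=
  rfl

/-- **Mathlib's normed bump functions are mollifiers**: for every `f : ContDiffBump 0` on `ℝ^d`,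
`f.normed volume` is smooth, compactly supported, even, nonnegative and has integral one
(Mathlib `ContDiffBump.contDiff_normed`, `hasCompactSupport_normed`, `normed_neg`,
`nonneg_normed`, `integral_normed`; Evans, App. C.4). In particular mollifiers exist. [folklore] -/
theorem isMollifier_normed (f : ContDiffBump (0 : EuclideanSpace ℝ d)) :
    IsMollifier (f.normed volume) :=
  ⟨f.contDiff_normed, f.hasCompactSupport_normed, f.normed_neg, f.nonneg_normed,
    f.integral_normed⟩

/-- Mollifiers exist on `ℝ^d` (from `isMollifier_normed` and any bump, e.g. radii `1 < 2`). [folklore] -/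
theorem exists_isMollifier : ∃ φ : EuclideanSpace ℝ d → ℝ, IsMollifier φ :=
  ⟨_, isMollifier_normed ⟨1, 2, one_pos, one_lt_two⟩⟩

/-- The rescaled mollifier still has integral one for `ε > 0`:
`∫ ε^{-d} φ(ξ/ε) dξ = ∫ φ = 1` (Haar rescaling `Measure.integral_comp_inv_smul_of_nonneg` and
`finrank ℝ ℝ^d = card d`; Evans, App. C.4). [folklore] -/
theorem integral_mollifierScale {φ : EuclideanSpace ℝ d → ℝ} (hφ : IsMollifier φ) {ε : ℝ}
    (hε : 0 < ε) : ∫ ξ, mollifierScale ε φ ξ = 1 := by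
  simp only [mollifierScale]
  rw [integral_const_mul, Measure.integral_comp_inv_smul_of_nonneg volume φ hε.le,
    finrank_euclideanSpace, hφ.2.2.2.2, smul_eq_mul, mul_one,
    inv_mul_cancel₀ (pow_ne_zero _ hε.ne')]

/-- A rescaled mollifier is a mollifier for `ε > 0` (smoothness, support, parity and sign are
preserved by the linear rescaling; the integral by `integral_mollifierScale`; Evans, App. C.4). [folklore] -/
theorem IsMollifier.mollifierScale {φ : EuclideanSpace ℝ d → ℝ} (hφ : IsMollifier φ) {ε : ℝ}
    (hε : 0 < ε) : IsMollifier (mollifierScale ε φ) := by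
  obtain ⟨hs, hc, he, hp, -⟩ := id hφ
  refine ⟨contDiff_const.mul (hs.comp (contDiff_const_smul ε⁻¹)), ?_, fun ξ => ?_, fun ξ => ?_,
    integral_mollifierScale hφ hε⟩
  · exact (hc.comp_smul (inv_ne_zero hε.ne')).mul_left
  · rw [mollifierScale_apply, mollifierScale_apply, smul_neg, he]
  · exact mul_nonneg (inv_nonneg.2 (pow_nonneg hε.le _)) (hp _)

end Literature.Analysis.FluidPDE

namespace Literature.Analysis.FluidPDE.Torus

variable {d : Type*} [Fintype d]

/-! ## Weak-* convergence in `L^∞_t L²_x` -/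

/-- **Weak-* convergence in `L^∞(0,T; L²(T^d))` on bounded sets** of a sequence of fields
`u_m → u` (DiPerna–Majda 1987, §1, (1.4)–(1.5): `u^ε ⇀ u` weak-* in `L^∞(0,T; L²)`): the
sequence is bounded in `L^∞_t L²_x`, and `∫₀ᵀ∫ ⟪u_m, ψ⟫ → ∫₀ᵀ∫ ⟪u, ψ⟫` for every smooth
space–time test field `ψ` supported in `(0, T)` (these are dense in `L¹(0,T; L²)`, so on bounded
sets this is weak-* convergence). [cite: DiPernaMajda1987, §1  (1.4] -/
def TendstoWeakStar (useq : ℕ → ℝ → UnitAddTorus d → EuclideanSpace ℝ d)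
    (u : ℝ → UnitAddTorus d → EuclideanSpace ℝ d) (T : ℝ) : Prop :=
  (∃ C : ℝ≥0, ∀ m, ∀ᵐ t ∂(volume.restrict (Ioo 0 T)), ∫⁻ x, ‖useq m t x‖ₑ ^ 2 ≤ C) ∧
    ∀ ψ : ℝ → UnitAddTorus d → EuclideanSpace ℝ d, FunctionSpaces.Torus.IsSpaceTimeTestIoo T ψ →
      Tendsto (fun m => ∫ t in Ioo 0 T, ∫ x, ⟪useq m t x, ψ t x⟫) atTop
        (𝓝 (∫ t in Ioo 0 T, ∫ x, ⟪u t x, ψ t x⟫))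

/-- Weak-* convergence passes to subsequences (DiPerna–Majda 1987, §1; elementary:
`Tendsto.comp` with `StrictMono.tendsto_atTop`). [cite: DiPernaMajda1987, §1] -/
theorem TendstoWeakStar.comp {useq : ℕ → ℝ → UnitAddTorus d → EuclideanSpace ℝ d}
    {u : ℝ → UnitAddTorus d → EuclideanSpace ℝ d} {T : ℝ} (h : TendstoWeakStar useq u T)
    {φ : ℕ → ℕ} (hφ : StrictMono φ) : TendstoWeakStar (useq ∘ φ) u T := by
  obtain ⟨⟨C, hC⟩, hlim⟩ := h
  exact ⟨⟨C, fun m => hC (φ m)⟩, fun ψ hψ => (hlim ψ hψ).comp hφ.tendsto_atTop⟩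

/-! ## Weak gradients on `T^d` and the dissipation density -/

/-- `G : T^d → (ℝ^d →L[ℝ] ℝ^d)` is a **weak gradient** of `v : T^d → ℝ^d`: for every coordinate
direction `eᵢ = EuclideanSpace.single i 1`, `x ↦ G x eᵢ` is a weak `i`-th partial derivative of
`v` in the sense of the accepted G03 `Torus.HasWeakPartialDeriv` (Evans, §5.2.1). Torus twin of
the accepted `Fluid.HasWeakGradient`. [folklore] -/
def HasWeakGradient [DecidableEq d] (v : UnitAddTorus d → EuclideanSpace ℝ d)
    (G : UnitAddTorus d → EuclideanSpace ℝ d →L[ℝ] EuclideanSpace ℝ d) : Prop :=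
  ∀ i, FunctionSpaces.Torus.HasWeakPartialDeriv i v (fun x => G x (EuclideanSpace.single i 1))

/-- The pointwise **dissipation density** `|∇u(x)|²` of a (weak) gradient field `G` at `x` — the
squared Frobenius (Hilbert–Schmidt) norm of `G x`, i.e. the accepted basis-free
`Fluid.frobeniusNormSq (G x)`; in the standard basis `∑ᵢ ‖G x eᵢ‖²` (`weakGradNormSq_eq_sum`)
(Duchon–Robert 2000, (3): `ν |∇u|²`; DiPerna–Majda 1987, §1). [cite: DuchonRobert2000, (3] -/
def weakGradNormSq
    (G : UnitAddTorus d → EuclideanSpace ℝ d →L[ℝ] EuclideanSpace ℝ d) (x : UnitAddTorus d) : ℝ :=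
  FluidPDE.frobeniusNormSq (G x)

/-- Unfolding: the dissipation density is the Frobenius norm squared of `G x`. [folklore] -/
theorem weakGradNormSq_eq_frobeniusNormSq
    (G : UnitAddTorus d → EuclideanSpace ℝ d →L[ℝ] EuclideanSpace ℝ d) (x : UnitAddTorus d) :
    weakGradNormSq G x = FluidPDE.frobeniusNormSq (G x) :=
  rfl

/-- The dissipation density is nonnegative (`Fluid.frobeniusNormSq_nonneg`). [folklore] -/
theorem weakGradNormSq_nonneg
    (G : UnitAddTorus d → EuclideanSpace ℝ d →L[ℝ] EuclideanSpace ℝ d) (x : UnitAddTorus d) :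
    0 ≤ weakGradNormSq G x :=
  FluidPDE.frobeniusNormSq_nonneg _

/-- The dissipation density in the standard basis: `|∇u(x)|² = ∑ᵢ ‖G x eᵢ‖²` with
`eᵢ = EuclideanSpace.single i 1` (`Fluid.frobeniusNormSq_eq_sum` for the orthonormal basis
`EuclideanSpace.basisFun`; Duchon–Robert 2000, (3)). [cite: DuchonRobert2000, (3] -/
theorem weakGradNormSq_eq_sum
    [DecidableEq d] (G : UnitAddTorus d → EuclideanSpace ℝ d →L[ℝ] EuclideanSpace ℝ d)
    (x : UnitAddTorus d) :
    weakGradNormSq G x = ∑ i, ‖G x (EuclideanSpace.single i 1)‖ ^ 2 := by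
  rw [weakGradNormSq, FluidPDE.frobeniusNormSq_eq_sum (EuclideanSpace.basisFun d ℝ)]
  simp

/-- For smooth `v`, the torus Fréchet derivative `Torus.fderiv v` is a weak gradient
(`partialDeriv_eq_fderiv_apply`; Evans, §5.2.1), given that classical partial derivatives of
smooth fields are weak ones — the G03 result `Torus.IsSmooth.hasWeakPartialDeriv` (integration by
parts on the torus), vendored upstream and taken here as the explicit hypothesis `hwpd`. [folklore] -/
theorem _root_.Literature.Analysis.FunctionSpaces.Torus.IsSmooth.hasWeakGradient [DecidableEq d]
    (hwpd : ∀ {f : UnitAddTorus d → EuclideanSpace ℝ d}, FunctionSpaces.Torus.IsSmooth f →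
      ∀ i : d, FunctionSpaces.Torus.HasWeakPartialDeriv i f (FunctionSpaces.Torus.partialDeriv i f))
    {v : UnitAddTorus d → EuclideanSpace ℝ d} (hv : FunctionSpaces.Torus.IsSmooth v) :
    HasWeakGradient v (FunctionSpaces.Torus.fderiv v) := by
  intro i
  have h := hwpd hv i
  have heq : FunctionSpaces.Torus.partialDeriv i v = fun x => FunctionSpaces.Torus.fderiv v x (EuclideanSpace.single i 1) :=
    funext fun x => FunctionSpaces.Torus.partialDeriv_eq_fderiv_apply (hv.isContDiff (by simp)) i x
  rwa [heq] at h

/-- Weak gradients of a field are unique a.e., among integrable candidates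
(`HasWeakPartialDeriv.unique` in each direction; Evans, §5.2.1). [cite: Evans2010, §5.2.1] -/
def HasWeakGradient.unique : Prop :=
  ∀ [DecidableEq d] {v : UnitAddTorus d → EuclideanSpace ℝ d} {G G' : UnitAddTorus d → EuclideanSpace ℝ d →L[ℝ] EuclideanSpace ℝ d} (hG : Integrable G volume) (hG' : Integrable G' volume) (h : HasWeakGradient v G) (h' : HasWeakGradient v G'),
    G =ᵐ[volume] G'

/-! ## Dissipation measures of vanishing-viscosity sequences -/

/-- The **dissipation measure** `ν |∇u|² dx dt` on `[0, T] × T^d` of a field with viscosity `ν`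
and (weak) spatial gradient `G t` at time `t`: Lebesgue measure on `ℝ × T^d` restricted to
`[0, T] × T^d`, with density `ν · weakGradNormSq (G t) x` (DiPerna–Majda 1987, §1;
Duchon–Robert 2000, (3) and Prop. 2; Buckmaster–Vicol 2019, §8). For `ν < 0` the density is
truncated to `0` by `ENNReal.ofReal` (irrelevant: `ν ≥ 0` in all uses). [cite: DiPernaMajda1987, §1] -/
def dissipationMeasure (ν : ℝ)
    (G : ℝ → UnitAddTorus d → EuclideanSpace ℝ d →L[ℝ] EuclideanSpace ℝ d) (T : ℝ) :
    Measure (ℝ × UnitAddTorus d) :=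
  (volume.restrict (Icc 0 T ×ˢ univ)).withDensity
    fun z => ENNReal.ofReal (ν * weakGradNormSq (G z.1) z.2)

/-- `D` is a **dissipation measure of the sequence** `(ν_m, u_m)` on `[0, T] × T^d`: there are
jointly a.e.-strongly measurable fields `G_m` on `[0, T] × T^d` such that `G_m t` is a weak
spatial gradient of `u_m t` for a.e. `t ∈ (0, T)`, integrable in `x` (hence a.e. unique,
`HasWeakGradient.unique`; joint measurability makes `dissipationMeasure (ν_m) (G_m) T`
independent of the representative, `withDensity_congr_ae`), with `ν_m |∇u_m|² dx dt` finite
measures converging weakly (against bounded continuous functions) to the finite measure `D`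
(DiPerna–Majda 1987, §1, the "reduced defect measure" set-up; Buckmaster–Vicol 2019, §8:
`ν|∇u^ν|² dx dt ⇀ D`). Joint measurability is phrased with `uncurry (G_m)` on `ℝ × T^d`
(restricted to `[0, T] × T^d`) rather than with the accepted `stLift` on `ℝ × ℝ^d` used for
velocities, because `uncurry (G_m)` is exactly the density `withDensity` consumes on `ℝ × T^d`.
Junk: `HasWeakPartialDeriv` uses Bochner pairings, so a non-integrable slice `u_m t` admits
`G_m t = 0` as a "weak gradient"; harmless here since in all uses (Leray–Hopf sequences) the
slices are in `L²`. [cite: DiPernaMajda1987, §1  the "reduced defect measure" set-up] -/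
def IsDissipationMeasureOf [DecidableEq d] (νseq : ℕ → ℝ)
    (useq : ℕ → ℝ → UnitAddTorus d → EuclideanSpace ℝ d) (T : ℝ)
    (D : Measure (ℝ × UnitAddTorus d)) : Prop :=
  ∃ Gseq : ℕ → ℝ → UnitAddTorus d → EuclideanSpace ℝ d →L[ℝ] EuclideanSpace ℝ d,
    (∀ m, AEStronglyMeasurable (uncurry (Gseq m)) (volume.restrict (Icc 0 T ×ˢ univ))) ∧
    (∀ m, ∀ᵐ t ∂(volume.restrict (Ioo 0 T)),
      HasWeakGradient (useq m t) (Gseq m t) ∧ Integrable (Gseq m t) volume) ∧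
    (∀ m, IsFiniteMeasure (dissipationMeasure (νseq m) (Gseq m) T)) ∧
    IsFiniteMeasure D ∧
    ∀ g : (ℝ × UnitAddTorus d) →ᵇ ℝ,
      Tendsto (fun m => ∫ z, g z ∂(dissipationMeasure (νseq m) (Gseq m) T)) atTop
        (𝓝 (∫ z, g z ∂D))

/-- **Anomalous dissipation** of a limiting dissipation measure: `D` charges the open slab
`(0, T) × T^d`, i.e. `D((0,T) × T^d) > 0` — the zeroth law of turbulence in measure form
(Buckmaster–Vicol 2019, §8; Duchon–Robert 2000, Prop. 2: `D(u) = lim ν|∇u^ν|²`). Argument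
order `T` first, as for the other predicates of this file. [cite: BuckmasterVicol2019, §8] -/
def HasAnomalousDissipationMeasure (T : ℝ) (D : Measure (ℝ × UnitAddTorus d)) : Prop :=
  0 < D (Ioo 0 T ×ˢ univ)

variable {T ν : ℝ} {f u : ℝ → UnitAddTorus d → EuclideanSpace ℝ d}
  {u₀ : UnitAddTorus d → EuclideanSpace ℝ d}

/-- **Leray–Hopf solutions on the torus have weak gradients in `L²`.** If `u` is Leray–Hopf on
`[0, T)`, then there is a jointly a.e.-strongly measurable `G` on `[0, T] × T^d` such that for
a.e. `t ∈ (0, T)` the slice `G t` is an integrable weak gradient of `u t` whose squared `L²` norm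
is the spectral dissipation `eGradNormSq (u t)`: `∫⁻ |G t|² = 4π² ∑ₖ |k|² |û(t, k)|²`. This is
the link from the spectral class `MemL2Sobolev 0 T 1` (field `memL2Sobolev`) to weak `H¹` via the
accepted `Torus.memSobolev_nat_iff_hasWeakPartialDeriv` (`k = 0`) and Parseval; joint
measurability from the (jointly measurable) Fourier partial sums (Temam, Ch. III Thm. 3.1; Evans,
§5.8.4 Thm. 8, §5.9.2; Grafakos, Prop. 3.2.6 (8)). [cite: Evans2010, §5.9.2] -/
def IsLerayHopfOn.exists_hasWeakGradient : Prop :=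
  ∀ [DecidableEq d] (h : IsLerayHopfOn T ν f u₀ u),
    ∃ G : ℝ → UnitAddTorus d → EuclideanSpace ℝ d →L[ℝ] EuclideanSpace ℝ d,
      AEStronglyMeasurable (uncurry G) (volume.restrict (Icc 0 T ×ˢ univ)) ∧
      ∀ᵐ t ∂(volume.restrict (Ioo 0 T)),
        HasWeakGradient (u t) (G t) ∧ Integrable (G t) volume ∧
          ∫⁻ x, ENNReal.ofReal (weakGradNormSq (G t) x) = FunctionSpaces.Torus.eGradNormSq (u t)

/-- The dissipation measure of a torus Leray–Hopf solution built from the (jointly measurable)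
weak gradient of `exists_hasWeakGradient` has total mass at most the initial energy plus the
work of the force: `ν ∫₀ᵀ∫ |∇u|² ≤ ½‖u₀‖² + ∫₀ᵀ∫ ⟪f, u⟫` (Tonelli and the energy inequality
from `0`, field `energy_ineq_zero`, at `t = T`; Leray 1934, (5.2)). Stated for `ν ≥ 0`,
`T ≥ 0`. [cite: Leray1934, (5.2] -/
def IsLerayHopfOn.exists_dissipationMeasure_univ_le : Prop :=
  ∀ [DecidableEq d] (h : IsLerayHopfOn T ν f u₀ u) (hν : 0 ≤ ν) (hT : 0 ≤ T),
    ∃ G : ℝ → UnitAddTorus d → EuclideanSpace ℝ d →L[ℝ] EuclideanSpace ℝ d,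
      AEStronglyMeasurable (uncurry G) (volume.restrict (Icc 0 T ×ˢ univ)) ∧
      (∀ᵐ t ∂(volume.restrict (Ioo 0 T)), HasWeakGradient (u t) (G t) ∧ Integrable (G t) volume) ∧
        dissipationMeasure ν G T univ ≤
          ENNReal.ofReal (FunctionSpaces.Torus.kineticEnergy u₀ + ∫ τ in 0..T, ∫ x, ⟪f τ x, u τ x⟫)

/-- **Compactness of dissipation measures** (DiPerna–Majda 1987, §1; Buckmaster–Vicol 2019,
§8). Let `u_m` be unforced Leray–Hopf solutions on `T^d × [0, T)` with viscosities `ν_m ≥ 0`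
and data `u₀^m` of uniformly bounded kinetic energy. Then along a subsequence the dissipation
measures `ν_m |∇u_m|² dx dt` — finite measures on the compact `[0, T] × T^d` with uniformly
bounded mass by the energy inequality (`IsLerayHopfOn.exists_dissipationMeasure_univ_le`) —
converge weakly to a finite measure `D` (Banach–Alaoglu / Prokhorov). For `T < 0` everything is
the zero measure. [cite: DiPernaMajda1987, §1] -/
def exists_subseq_isDissipationMeasureOf_of_isLerayHopfOn : Prop :=
  ∀ [DecidableEq d] {νseq : ℕ → ℝ} {useq : ℕ → ℝ → UnitAddTorus d → EuclideanSpace ℝ d} {u₀seq : ℕ → UnitAddTorus d → EuclideanSpace ℝ d} (hν : ∀ m, 0 ≤ νseq m) (hLH : ∀ m, IsLerayHopfOn T (νseq m) 0 (u₀seq m) (useq m)) (hE : ∃ C : ℝ, ∀ m, FunctionSpaces.Torus.kineticEnergy (u₀seq m) ≤ C),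
    ∃ φ : ℕ → ℕ, StrictMono φ ∧ ∃ D : Measure (ℝ × UnitAddTorus d),
      IsDissipationMeasureOf (νseq ∘ φ) (useq ∘ φ) T D

/-- **Compactness of dissipation measures in the vanishing-viscosity set-up** (DiPerna–Majda
1987, §1, (1.4)–(1.5); Buckmaster–Vicol 2019, §8): unforced Leray–Hopf solutions `u_m` with
viscosities `ν_m ≥ 0`, data of uniformly bounded energy, converging weak-* in `L^∞_t L²_x` to
`u`, have — along a subsequence still converging weak-* to `u` (`TendstoWeakStar.comp`) — a
limiting dissipation measure `D` (from `exists_subseq_isDissipationMeasureOf_of_isLerayHopfOn`). [cite: BuckmasterVicol2019, §8] -/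
def TendstoWeakStar.exists_subseq_isDissipationMeasureOf : Prop :=
  ∀ [DecidableEq d] {νseq : ℕ → ℝ} {useq : ℕ → ℝ → UnitAddTorus d → EuclideanSpace ℝ d} {u₀seq : ℕ → UnitAddTorus d → EuclideanSpace ℝ d} (hconv : TendstoWeakStar useq u T) (hν : ∀ m, 0 ≤ νseq m) (hLH : ∀ m, IsLerayHopfOn T (νseq m) 0 (u₀seq m) (useq m)) (hE : ∃ C : ℝ, ∀ m, FunctionSpaces.Torus.kineticEnergy (u₀seq m) ≤ C),
    ∃ φ : ℕ → ℕ, StrictMono φ ∧ TendstoWeakStar (useq ∘ φ) u T ∧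
      ∃ D : Measure (ℝ × UnitAddTorus d), IsDissipationMeasureOf (νseq ∘ φ) (useq ∘ φ) T D

/- interim proof relied on results that are now named facts (D-0014); demoted to a fact by the M5 import, proof preserved:
:= by
  obtain ⟨φ, hφ, hD⟩ := exists_subseq_isDissipationMeasureOf_of_isLerayHopfOn hν hLH hE
  exact ⟨φ, hφ, hconv.comp hφ, hD⟩
-/

/-- **Uniqueness of the dissipation measure** of a given sequence `(ν_m, u_m)`: two dissipation
measures of the same sequence coincide. The chosen weak gradients agree a.e. in `x` for a.e. `t`
(`HasWeakGradient.unique`), hence — being jointly a.e.-strongly measurable, so that the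
disagreement set is measurable and Fubini/`Measure.ae_prod_iff_ae_ae` applies — a.e. on
`[0, T] × T^d`; so the approximating measures coincide (`withDensity_congr_ae`), and weak limits
of finite Borel measures on the metrisable space `ℝ × T^d` are unique (bounded continuous
functions separate finite Borel measures; Billingsley, *Convergence of probability measures*,
Thm. 1.2; DiPerna–Majda 1987, §1). [cite: DiPernaMajda1987, §1] -/
def IsDissipationMeasureOf.unique : Prop :=
  ∀ [DecidableEq d] {νseq : ℕ → ℝ} {useq : ℕ → ℝ → UnitAddTorus d → EuclideanSpace ℝ d} {D D' : Measure (ℝ × UnitAddTorus d)} (h : IsDissipationMeasureOf νseq useq T D) (h' : IsDissipationMeasureOf νseq useq T D'),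
    D = D'

/-! ## Duchon–Robert: increments, the local flux `D_ε`, the defect distribution -/

section Increment

variable {F : Type*} [AddCommGroup F]

omit [Fintype d] in
/-- The **increment** `δu(x; ξ) = u(x + ξ) − u(x)` of a field on `T^d` for a separation vector
`ξ ∈ ℝ^d` acting by translation through the covering map (Duchon–Robert 2000, before (9):
`δu = u(x + ξ) − u(x)`; Frisch 1995, §6.1). **Verbatim twin** of the accepted
`Literature.Turb.velocityIncrement u ⇑ξ x = u (x + Turb.toTorus ⇑ξ) - u x` (Statements/Turb/Wave0):
`Torus.proj ξ = Turb.toTorus ⇑ξ` holds by `rfl`; the bridge lemma lives in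
`Statements/Turb/DuchonRobert`, which imports both files. [cite: DuchonRobert2000, before (9] -/
def increment (u : UnitAddTorus d → F) (ξ : EuclideanSpace ℝ d) (x : UnitAddTorus d) : F :=
  u (x + FunctionSpaces.Torus.proj ξ) - u x

omit [Fintype d] in
/-- Unfolding the increment. [folklore] -/
theorem increment_apply (u : UnitAddTorus d → F) (ξ : EuclideanSpace ℝ d) (x : UnitAddTorus d) :
    increment u ξ x = u (x + FunctionSpaces.Torus.proj ξ) - u x :=
  rfl

omit [Fintype d] in
/-- The increment at zero separation vanishes. [folklore] -/
@[simp]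
theorem increment_zero (u : UnitAddTorus d → F) (x : UnitAddTorus d) : increment u 0 x = 0 := by
  simp [increment]

end Increment

/-- The **Duchon–Robert local energy flux** at scale `ε`,
`D_ε(u)(x) = ¼ ∫_{ℝ^d} ∇φ^ε(ξ) · δu(x; ξ) |δu(x; ξ)|² dξ` for a mollifier `φ` and a velocity
slice `u : T^d → ℝ^d` (Duchon–Robert 2000, (9); Eyink 2003, (1.3)). The gradient is Mathlib's
`gradient` on `ℝ^d`; Bochner integral in `ξ` (junk `0` off integrability, harmless: `∇φ^ε` has
compact support and the predicate `HasDuchonRobertDefect` only tests `L³` fields in the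
literature). [cite: DuchonRobert2000, (9] -/
def duchonRobertApprox (φ : EuclideanSpace ℝ d → ℝ) (ε : ℝ)
    (u : UnitAddTorus d → EuclideanSpace ℝ d) (x : UnitAddTorus d) : ℝ :=
  4⁻¹ * ∫ ξ, ⟪_root_.gradient (FluidPDE.mollifierScale ε φ) ξ, increment u ξ x⟫ * ‖increment u ξ x‖ ^ 2

variable (d) in
/-- Space–time scalar functionals `(ℝ → T^d → ℝ) → ℝ`: the (unbundled, untopologised) type in
which the Duchon–Robert defect distribution `D(u)` and the limiting dissipation live, evaluated
on smooth test functions `ψ` with `IsSpaceTimeTestIoo T ψ` (Duchon–Robert 2000, Prop. 2: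
`D(u) ∈ 𝒟'((0,T) × T^d)`; v0 bookkeeping as for `Torus.Distribution`). [cite: DuchonRobert2000, Prop. 2:  D(u] -/
abbrev STFunctional : Type _ :=
  (ℝ → UnitAddTorus d → ℝ) → ℝ

/-- The functional `ψ ↦ ∫ ψ dD` induced by a measure on `ℝ × T^d` (how a dissipation measure is
compared with a Duchon–Robert defect; Duchon–Robert 2000, Prop. 2). [cite: DuchonRobert2000, Prop. 2] -/
def STFunctional.ofMeasure (D : Measure (ℝ × UnitAddTorus d)) : STFunctional d :=
  fun ψ => ∫ z, ψ z.1 z.2 ∂D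

/-- **The Duchon–Robert defect distribution.** `D : STFunctional d` is the inertial dissipation
defect of `u` on `(0, T) × T^d`: for every mollifier `φ` and every smooth test function `ψ`
supported in `(0, T)`, `∫₀ᵀ∫ D_ε(u) ψ → D ψ` as `ε → 0⁺` (Duchon–Robert 2000, Prop. 2 and (9):
the limit exists in `𝒟'` and is independent of `φ`; Eyink 2003, (1.3)–(1.4)). [cite: DuchonRobert2000, Prop. 2 and (9] -/
def HasDuchonRobertDefect (T : ℝ) (u : ℝ → UnitAddTorus d → EuclideanSpace ℝ d)
    (D : STFunctional d) : Prop :=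
  ∀ φ : EuclideanSpace ℝ d → ℝ, FluidPDE.IsMollifier φ → ∀ ψ : ℝ → UnitAddTorus d → ℝ,
    FunctionSpaces.Torus.IsSpaceTimeTestIoo T ψ →
      Tendsto (fun ε => ∫ t in Ioo 0 T, ∫ x, duchonRobertApprox φ ε (u t) x * ψ t x)
        (𝓝[>] 0) (𝓝 (D ψ))

/-- **The local energy balance with defect** (Duchon–Robert 2000, (10) / Prop. 2 (6)):
`∂ₜ(½|u|²) + div(u(½|u|² + p)) − νΔ(½|u|²) + ν|∇u|² + D(u) = 0` in `𝒟'((0,T) × T^d)`, tested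
against smooth scalar `ψ` supported in `(0, T)` after integrating by parts onto `ψ`:
`∫₀ᵀ∫ [½|u|² ∂ₜψ + (½|u|² + p) ⟪u, ∇ψ⟫ + ½ν|u|² Δψ − ν|∇u|² ψ] = D ψ`.
The weak spatial gradient `G` is an explicit argument; it is required to be a weak gradient of
`u t` for a.e. `t` only when `ν ≠ 0` (for Euler, `ν = 0`, the viscous terms drop out and `G` is
irrelevant). Bochner integrals: meaningful for `u ∈ L³_{t,x}`, `p ∈ L^{3/2}_{t,x}`, `∇u ∈ L²`
(DR Prop. 2 hypotheses), which statements add. [cite: DuchonRobert2000, (10] -/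
def HasLocalEnergyBalance [DecidableEq d] (T ν : ℝ) (u : ℝ → UnitAddTorus d → EuclideanSpace ℝ d)
    (p : ℝ → UnitAddTorus d → ℝ)
    (G : ℝ → UnitAddTorus d → EuclideanSpace ℝ d →L[ℝ] EuclideanSpace ℝ d)
    (D : STFunctional d) : Prop :=
  (ν ≠ 0 → ∀ᵐ t ∂(volume.restrict (Ioo 0 T)), HasWeakGradient (u t) (G t)) ∧
    ∀ ψ : ℝ → UnitAddTorus d → ℝ, FunctionSpaces.Torus.IsSpaceTimeTestIoo T ψ →
      ∫ t in Ioo 0 T, ∫ x,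
        (2⁻¹ * ‖u t x‖ ^ 2 * FunctionSpaces.Torus.timeDeriv ψ t x +
          (2⁻¹ * ‖u t x‖ ^ 2 + p t x) * ⟪u t x, FunctionSpaces.Torus.gradient (ψ t) x⟫ +
          2⁻¹ * ν * ‖u t x‖ ^ 2 * FunctionSpaces.Torus.laplacian (ψ t) x -
          ν * weakGradNormSq (G t) x * ψ t x) = D ψ

/-- **Independence of the mollifier / uniqueness of the defect**: two Duchon–Robert defects of
the same field agree on all test functions supported in `(0, T)` (Duchon–Robert 2000, Prop. 2:
"the limit is independent of `φ`"; here simply uniqueness of limits along `𝓝[>] 0`, using that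
mollifiers exist, `Fluid.exists_isMollifier`). [cite: DuchonRobert2000, Prop. 2: "the limit is independent of  φ] -/
theorem HasDuchonRobertDefect.unique {D D' : STFunctional d} (h : HasDuchonRobertDefect T u D)
    (h' : HasDuchonRobertDefect T u D') {ψ : ℝ → UnitAddTorus d → ℝ}
    (hψ : FunctionSpaces.Torus.IsSpaceTimeTestIoo T ψ) : D ψ = D' ψ := by
  obtain ⟨φ, hφ⟩ := FluidPDE.exists_isMollifier (d := d)
  exact tendsto_nhds_unique (h φ hφ ψ hψ) (h' φ hφ ψ hψ)

/-- **No defect for smooth fields**: if `u` is jointly smooth on `[0, T] × T^d`, then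
`∫₀ᵀ∫ D_ε(u) ψ → 0` as `ε → 0⁺` for every mollifier and every test function supported in
`(0, T)` — indeed `|D_ε(u)(x)| ≤ C ε⁻¹ · ε³ ‖∇u‖³_∞ ∫|∇φ|` since `|δu(x;ξ)| ≤ ‖∇u‖_∞ |ξ|` and
`|ξ| ≤ Cε` on the support of `∇φ^ε` (Duchon–Robert 2000, discussion after Prop. 2 and §4:
`D(u) = 0` for `u` of Besov regularity `> 1/3`, a fortiori for smooth `u`; Eyink 2003, §1). [cite: DuchonRobert2000, discussion after Prop. 2 and §4:  D(u] -/
def duchonRobertApprox_smooth_tendsto_zero : Prop :=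
  ∀ (hu : FunctionSpaces.Torus.IsSmoothSpaceTimeOn (Icc 0 T) u) {φ : EuclideanSpace ℝ d → ℝ} (hφ : FluidPDE.IsMollifier φ) {ψ : ℝ → UnitAddTorus d → ℝ} (hψ : FunctionSpaces.Torus.IsSpaceTimeTestIoo T ψ),
    Tendsto (fun ε => ∫ t in Ioo 0 T, ∫ x, duchonRobertApprox φ ε (u t) x * ψ t x)
      (𝓝[>] 0) (𝓝 0)

/-- Smooth fields have zero Duchon–Robert defect (`duchonRobertApprox_smooth_tendsto_zero`;
Duchon–Robert 2000, Prop. 2 ff.). [cite: DuchonRobert2000, Prop. 2 ff] -/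
def hasDuchonRobertDefect_zero_of_smooth : Prop :=
  ∀ (hu : FunctionSpaces.Torus.IsSmoothSpaceTimeOn (Icc 0 T) u),
    HasDuchonRobertDefect T u 0

/- interim proof relied on results that are now named facts (D-0014); demoted to a fact by the M5 import, proof preserved:
:=
  fun _ hφ _ hψ => duchonRobertApprox_smooth_tendsto_zero hu hφ hψ
-/

/-- **Vanishing-viscosity limits dissipate through the defect** (Duchon–Robert 2000, Prop. 4 /
(15): if Leray–Hopf solutions `u^ν → u` strongly in `L³((0,T) × T^d)` as `ν → 0`, then
`ν|∇u^ν|² + D(u^ν) ⇀ D(u)` in `𝒟'`): under strong `L³_{t,x}` convergence along a sequence of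
Leray–Hopf solutions *without viscous defect* (`D(u_m) = 0`, e.g. `u_m` regular enough for the
energy equality), any dissipation measure `D` of `(ν_m, u_m)` represents the Duchon–Robert defect
of the limit: `∫ ψ dD = D(u)(ψ)` on test functions supported in `(0, T)`. The limit `u` is
assumed jointly a.e.-strongly measurable and in `L³_{t,x}`. [cite: DuchonRobert2000, Prop. 4 / (15] -/
def IsDissipationMeasureOf.hasDuchonRobertDefect : Prop :=
  ∀ [DecidableEq d] {νseq : ℕ → ℝ} {useq : ℕ → ℝ → UnitAddTorus d → EuclideanSpace ℝ d} {D : Measure (ℝ × UnitAddTorus d)} (hD : IsDissipationMeasureOf νseq useq T D) (hν : Tendsto νseq atTop (𝓝[>] 0)) (hLH : ∀ m, ∃ u₀, IsLerayHopfOn T (νseq m) 0 u₀ (useq m)) (hdef : ∀ m, HasDuchonRobertDefect T (useq m) 0) (hmeas : AEStronglyMeasurable (FunctionSpaces.Torus.stLift u) (volume.restrict (Ioo 0 T ×ˢ univ))) (hL3 : Tendsto (fun m => ∫⁻ t in Ioo 0 T, ∫⁻ x, ‖useq m t x - u t x‖ₑ ^ (3 : ℕ)) atTop (𝓝 0)) (hu3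 : ∫⁻ t in Ioo 0 T, ∫⁻ x, ‖u t x‖ₑ ^ (3 : ℕ) < ∞),
    HasDuchonRobertDefect T u (STFunctional.ofMeasure D)

/-! ## Sphere-averaged fluxes: the 4/5 and 4/3 laws -/

/-- The **spherical average** `⨍_{S^{d-1}} h(ω) dω` of `h : ℝ^d → ℝ` over unit vectors, w.r.t.
the surface measure `volume.toSphere` induced by Lebesgue measure (Mathlib `Measure.toSphere`,
normalised by Mathlib's average `⨍`; Eyink 2003, (1.5): `∫ dω/4π` in `d = 3`). Junk `0` when the
sphere has measure zero (`d` empty). [cite: Eyink2003, (1.5] -/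
def sphereAvg (h : EuclideanSpace ℝ d → ℝ) : ℝ :=
  ⨍ ω, h ω ∂(volume : Measure (EuclideanSpace ℝ d)).toSphere

/-- The **sphere-averaged third-order longitudinal structure function** at scale `ℓ` and point
`x`: `⨍_{S^{d-1}} (δu(x; ℓω) · ω)³ dω` (Eyink 2003, (1.5)–(1.7): `⟨(δ_L u)³⟩_{ang}`;
Duchon–Robert 2000, §4). Not averaged in `x` or `t`: the local laws pair it with test
functions. [cite: Eyink2003, (1.5] -/
def longitudinalFluxSphereAvg (u : UnitAddTorus d → EuclideanSpace ℝ d) (ℓ : ℝ)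
    (x : UnitAddTorus d) : ℝ :=
  sphereAvg fun ω => ⟪increment u (ℓ • ω) x, ω⟫ ^ 3

/-- The **sphere-averaged energy flux** at scale `ℓ` and point `x`:
`⨍_{S^{d-1}} (δu(x; ℓω) · ω) |δu(x; ℓω)|² dω` (Eyink 2003, (1.5)–(1.6): `⟨δ_L u |δu|²⟩_{ang}`,
the 4/3-law quantity; Duchon–Robert 2000, (11)–(12)). [cite: Eyink2003, (1.5] -/
def energyFluxSphereAvg (u : UnitAddTorus d → EuclideanSpace ℝ d) (ℓ : ℝ) (x : UnitAddTorus d) :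
    ℝ :=
  sphereAvg fun ω => ⟪increment u (ℓ • ω) x, ω⟫ * ‖increment u (ℓ • ω) x‖ ^ 2

variable (d) in
/-- The **4/5-law constant** in dimension `d`: `12 / (d(d+2))`, equal to `4/5` for `d = 3`
(`fourFifthsConst_fin_three`); it arises from the angular moment
`⨍ ωᵢωⱼωₖω_l dω = (δᵢⱼδₖₗ + δᵢₖδⱼₗ + δᵢₗδⱼₖ)/(d(d+2))` (Eyink 2003, (1.7) and its derivation in
§2). Junk `12/0 = 0` for empty `d`. [cite: Eyink2003, (1.7] -/
def fourFifthsConst : ℝ :=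
  12 / ((Fintype.card d : ℝ) * (Fintype.card d + 2))

variable (d) in
/-- The **4/3-law constant** in dimension `d`: `4 / d`, equal to `4/3` for `d = 3`
(`fourThirdsConst_fin_three`), from `⨍ ωᵢωⱼ dω = δᵢⱼ/d` (Eyink 2003, (1.6); Duchon–Robert 2000,
(11)–(12)). Junk `4/0 = 0` for empty `d`. [cite: Eyink2003, (1.6] -/
def fourThirdsConst : ℝ :=
  4 / (Fintype.card d : ℝ)

/-- In three dimensions the 4/5-law constant is `4/5`: `12 / (3 · 5) = 4/5` (Eyink 2003,
(1.7)). [cite: Eyink2003, (1.7] -/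
theorem fourFifthsConst_fin_three : fourFifthsConst (Fin 3) = 4 / 5 := by
  norm_num [fourFifthsConst]

/-- In three dimensions the 4/3-law constant is `4/3` (Eyink 2003, (1.6)). [cite: Eyink2003, (1.6] -/
theorem fourThirdsConst_fin_three : fourThirdsConst (Fin 3) = 4 / 3 := by
  norm_num [fourThirdsConst]

/-- **The local 4/5 law** in dimension `d` (Eyink 2003, (1.7); Duchon–Robert 2000, §4): in the
sense of distributions on `(0, T) × T^d`,
`lim_{ℓ→0⁺} ℓ⁻¹ ⨍ (δ_L u(ℓω))³ dω = −(12 / (d(d+2))) D(u)`, i.e. `−(4/5) D(u)` for `d = 3`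
(constant `fourFifthsConst d`). [cite: Eyink2003, (1.7] -/
def HasFourFifthsLaw (T : ℝ) (u : ℝ → UnitAddTorus d → EuclideanSpace ℝ d)
    (D : STFunctional d) : Prop :=
  ∀ ψ : ℝ → UnitAddTorus d → ℝ, FunctionSpaces.Torus.IsSpaceTimeTestIoo T ψ →
    Tendsto (fun ℓ => ∫ t in Ioo 0 T, ∫ x, ℓ⁻¹ * longitudinalFluxSphereAvg (u t) ℓ x * ψ t x)
      (𝓝[>] 0) (𝓝 (-fourFifthsConst d * D ψ))

/-- **The local 4/3 law** in dimension `d` (Eyink 2003, (1.6); Duchon–Robert 2000, (11)–(12)):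
in the sense of distributions on `(0, T) × T^d`,
`lim_{ℓ→0⁺} ℓ⁻¹ ⨍ δ_L u |δu|²(ℓω) dω = −(4/d) D(u)`, i.e. `−(4/3) D(u)` for `d = 3` (constant
`fourThirdsConst d`). [cite: Eyink2003, (1.6] -/
def HasFourThirdsLaw (T : ℝ) (u : ℝ → UnitAddTorus d → EuclideanSpace ℝ d)
    (D : STFunctional d) : Prop :=
  ∀ ψ : ℝ → UnitAddTorus d → ℝ, FunctionSpaces.Torus.IsSpaceTimeTestIoo T ψ →
    Tendsto (fun ℓ => ∫ t in Ioo 0 T, ∫ x, ℓ⁻¹ * energyFluxSphereAvg (u t) ℓ x * ψ t x)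
      (𝓝[>] 0) (𝓝 (-fourThirdsConst d * D ψ))

/-- **Duchon–Robert's 4/3 law for `L³` weak Euler solutions** (Duchon–Robert 2000, (11)–(12) and
Prop. 2, §4; Eyink 2003, Thm. 1 / (1.6)): if `u ∈ L³((0,T) × T^d)` is a **weak Euler solution**
(`IsWeakEulerSolutionOn T u`, which includes joint measurability of `u`) with Duchon–Robert
defect `D`, then the sphere-averaged energy flux satisfies the local 4/3 law with the same `D`.
The Euler equation is what upgrades the `φ`-averaged limits of `HasDuchonRobertDefect` to the
pointwise-in-`ℓ` shell limit (DR §4 derives (11)–(12) from the local energy balance). [cite: DuchonRobert2000, (11] -/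
def HasDuchonRobertDefect.hasFourThirdsLaw : Prop :=
  ∀ [DecidableEq d] {D : STFunctional d} (h : HasDuchonRobertDefect T u D) (hE : FunctionSpaces.Torus.IsWeakEulerSolutionOn T u) (hu3 : ∫⁻ t in Ioo 0 T, ∫⁻ x, ‖u t x‖ₑ ^ (3 : ℕ) < ∞),
    HasFourThirdsLaw T u D

/-- **Eyink's local 4/5 law for `L³` weak Euler solutions** (Eyink 2003, Thm. 1, (1.7)): if
`u ∈ L³((0,T) × T^d)` is a weak Euler solution with Duchon–Robert defect `D`, then the
sphere-averaged third-order longitudinal structure function satisfies the local 4/5 law. [cite: Eyink2003, Thm. 1  (1.7] -/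
def HasDuchonRobertDefect.hasFourFifthsLaw : Prop :=
  ∀ [DecidableEq d] {D : STFunctional d} (h : HasDuchonRobertDefect T u D) (hE : FunctionSpaces.Torus.IsWeakEulerSolutionOn T u) (hu3 : ∫⁻ t in Ioo 0 T, ∫⁻ x, ‖u t x‖ₑ ^ (3 : ℕ) < ∞),
    HasFourFifthsLaw T u D

end Literature.Analysis.FluidPDE.Torus
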